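import Summits.QuantumAdvantage.QuantumAdvantage.Theorems.CubicForrelationNearExactIsExactFourteenSecondLevelSeven

/-!
# Crux `CubicForrelation.NearExactIsExact` (stmt-QuantumAdvantage-14043) — n = 14 at the SECOND boundary `15/16`, level 6 with a
  BALANCED parity: impossible (two-sided)

Certificate seat `b2b-cforr-cert` (gen 9).  HONEST FRAMING: a theorem about cubic Boolean functions on 14 bits (finite slice `n = 14` of
the crux; one branch of the case analysis of `Φ ≥ 15/16 ⇒ Φ = 1`) — NOT summit progress.

Level 6: `W_g = 64·u'` with `p = [u' odd]` a non-zero QUADRATIC (`stub_walshTower`), `P = supp p`, budget `Σ_x (u' − 2s)² = 2¹⁷(1 − Φ) ≤ 2¹³`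
(`fl_budget6`), cost `≥ 1` on `P`, so `2¹² ≤ #P ≤ 2¹³`.  This file kills the sub-case `#P = 2¹³` (slack `0`): then `u' = 2s` off `P`,
`e := u' − 2s = ±1` on `P`, and `p` is BALANCED, so it has a complementing structure `c` (`p(x ⊕ c) = ¬p(x)`,
`stub_quadBalancedStructure`).  The `c`-periodic extension `Ẽ(x) := e(x) + e(x ⊕ c)` is `±1` everywhere and its parametrised `k`-flat
sums are the `(k+1)`-flat sums of `e` with the extra direction `c` (`fr_sum_peel`); by the general flat sums of `u'` (`fs_flat_sum_dvd`)
and of `s` (`sl_sum_sZ_flat`) these are `≡ 0 (mod 4)` for `k ≥ 3` and `≡ 0 (mod 16)` for `k = 6`.  Reading coordinate cubes as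
parametrised flats (`fo_sum_cube_eq_flat`), `Ẽ = (−1)^{h₁}` with `h₁` QUADRATIC (`bb_moebius_isDegLeFun`), and of rank `≤ 4`
(`ss_extract3` + `ss_flat_signsum6` would give a 6-flat with sign sum `±8`); the same holds for `h₂ = h₁ ⊕ p`.  Since
`u − 4s = 2e = (−1)^{h₁} − (−1)^{h₂}` (`u = W_g/32`), the period engine (`fp_l1_sq_mul_le`, radicals of size `≥ 2¹⁰`) bounds the pairing
`Σ_y (−1)^{g(y)} (u − 4s)^(y) = 2¹⁹` (`tms_pairing`) by `2¹⁶ + 2¹⁶`: contradiction (`fo_levelSix_balanced_false`).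

References: J. Ax (1964) / R. J. McEliece (1972); MacWilliams–Sloane (1977) Ch. 15 §2 (Dickson); R. O'Donnell (2014) §3.3;
C. Carlet (2021) §5.2.  Everything below is proved from Mathlib and the tree; axioms are the standard three.
-/

set_option linter.dupNamespace false -- D-0017: single-problem summit ⇒ `QuantumAdvantage.QuantumAdvantage` by design

noncomputable section

namespace Summit.QuantumAdvantage.QuantumAdvantage.Theorems.CubicForrelation.NearExactIsExact

open Finset
open Literature.Computability.QuantumComplexity
open Literature.Computability.QuantumComplexity.BuzetChailloux (bxor zeroVec bxor_bxor_cancel_left bxor_zeroVec zeroVec_bxor bxor_comm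
  bxor_self)
open Literature.Computability.QuantumComplexity.DerivativeWalsh (W)

variable {n : ℕ}

/-- **Coordinate cubes are parametrised flats.** The sum of `F` over the cube `E_I = {x : supp x ⊆ I}` is the parametrised flat sum
based at `0` with the unit vectors of `I` (in increasing order) as directions. [folklore] -/
theorem fo_sum_cube_eq_flat (F : (Fin n → Bool) → ℤ) (I : Finset (Fin n)) :
    ∑ x ∈ univ.filter (fun x : Fin n → Bool => ∀ i, x i = true → i ∈ I), F x =
      ∑ ε : Fin #I → Bool, F (fun j => (zeroVec : Fin n → Bool) j ^^ decide (Odd #(univ.filter fun i : Fin #I =>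
        ε i && (fun i : Fin #I => (Pi.single (I.orderEmbOfFin rfl i) true : Fin n → Bool)) i j))) := by
  classical
  set emb := I.orderEmbOfFin rfl with hemb
  set Φ : (Fin #I → Bool) → (Fin n → Bool) := fun ε j => (zeroVec : Fin n → Bool) j ^^ decide (Odd #(univ.filter
    fun i : Fin #I => ε i && (fun i : Fin #I => (Pi.single (emb i) true : Fin n → Bool)) i j)) with hΦ
  -- values of `Φ ε` on `I` and off `I`
  have hon : ∀ ε (i₀ : Fin #I), Φ ε (emb i₀) = ε i₀ := by
    intro ε i₀
    have hset : (univ.filter fun i : Fin #I => ε i && (Pi.single (emb i) true : Fin n → Bool) (emb i₀)) =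
        (if ε i₀ = true then {i₀} else ∅) := by
      ext i
      simp only [mem_filter, mem_univ, true_and, Pi.single_apply, Bool.and_eq_true]
      constructor
      · rintro ⟨hε, hs⟩
        have hi : i = i₀ := by
          by_contra hne
          have : (emb i₀ = emb i) = False := by
            simp only [eq_iff_iff, iff_false]; exact fun h => hne (emb.injective h).symm
          simp [this] at hs
        subst hi
        simp [hε]
      · intro hi
        by_cases hε : ε i₀ = true
        · rw [if_pos hε, mem_singleton] at hi; subst hi; exact ⟨hε, by simp⟩
        · rw [if_neg hε] at hi; exact absurd hi (notMem_empty _)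
    show ((zeroVec : Fin n → Bool) (emb i₀) ^^ decide (Odd #(univ.filter
      fun i : Fin #I => ε i && (Pi.single (emb i) true : Fin n → Bool) (emb i₀)))) = ε i₀
    rw [hset]
    cases ε i₀ <;> simp [zeroVec]
  have hoff : ∀ ε j, j ∉ I → Φ ε j = false := by
    intro ε j hj
    have hset : (univ.filter fun i : Fin #I => ε i && (Pi.single (emb i) true : Fin n → Bool) j) = ∅ := by
      refine filter_eq_empty_iff.2 fun i _ => ?_
      have hne : j ≠ emb i := fun h => hj (h ▸ I.orderEmbOfFin_mem rfl i)
      simp [hne]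
    show ((zeroVec : Fin n → Bool) j ^^ decide (Odd #(univ.filter
      fun i : Fin #I => ε i && (Pi.single (emb i) true : Fin n → Bool) j))) = false
    rw [hset]
    simp [zeroVec]
  have hsurj : ∀ j ∈ I, ∃ i, emb i = j := by
    intro j hj
    have : j ∈ Set.range emb := by rw [hemb, range_orderEmbOfFin]; exact hj
    exact this
  symm
  refine sum_nbij' Φ (fun x => fun i => x (emb i)) (fun ε _ => ?_) (fun x _ => mem_univ _) (fun ε _ => ?_) (fun x hx => ?_)
    (fun ε _ => rfl)
  · refine mem_filter.2 ⟨mem_univ _, fun j hj => ?_⟩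
    by_contra hjI
    rw [hoff ε j hjI] at hj
    exact Bool.false_ne_true hj
  · funext i; exact hon ε i
  · have hx' := (mem_filter.1 hx).2
    funext j
    by_cases hj : j ∈ I
    · obtain ⟨i, rfl⟩ := hsurj j hj
      exact hon _ i
    · rw [hoff _ j hj]
      cases hxj : x j with
      | false => rfl
      | true => exact absurd (hx' j hxj) hj


/-- Sign bookkeeping: `sZ b = 1 − 2·[b]`. [folklore] -/
theorem fo_sZ_eq (b : Bool) : sZ b = 1 - 2 * (if b = true then 1 else 0 : ℤ) := by cases b <;> rfl

/-- **Level 6 with a balanced parity never reaches `Φ = 15/16` on 14 bits.**  For cubic `f, g : 𝔽₂¹⁴ → 𝔽₂` with `W_g = 64·u'`,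
exactly `2¹³` odd values of `u'`, and `Φ(f,g) ≥ 15/16`: contradiction (the header describes the proof).  Finite-slice statement; NOT
summit progress. [this work] -/
theorem fo_levelSix_balanced_false (f g : (Fin (7 + 7) → Bool) → Bool) (hf : IsDegLeFun 3 f) (hg : IsDegLeFun 3 g)
    (u' : (Fin (7 + 7) → Bool) → ℤ) (hu' : ∀ x, W (fun y => signOf (g y)) x = (2 : ℝ) ^ 6 * (u' x : ℝ))
    (hP : #(univ.filter fun x : Fin (7 + 7) → Bool => Odd (u' x)) = 8192)
    (hΦ : (15 / 16 : ℝ) ≤ forrelation f g) : False := by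
  classical
  -- the parity is quadratic
  have hp : IsDegLeFun 2 (fun x => decide (Odd (u' x))) :=
    stub_walshTower stub_axParity (7 + 7) 6 2 g u' hg hu' (by intro k hk hkn; omega)
  -- `u = 2u'` at the Ax level
  set u : (Fin (7 + 7) → Bool) → ℤ := fun x => 2 * u' x with hudef
  have hu : ∀ x, W (fun y => signOf (g y)) x = (2 : ℝ) ^ 5 * (u x : ℝ) := by
    intro x; rw [hu' x]; simp only [u]; push_cast; ring
  have hu5 : ∀ x, W (fun y => signOf (g y)) x = (2 : ℝ) ^ (2 * 2 + 1) * (u x : ℝ) := fun x => (hu x).trans (by norm_num)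
  -- budget `Σ (u' − 2s)² ≤ 2¹³`, spent on the odd set
  have hbud := fl_budget6 f g u' hu'
  have hB : (∑ x, (u' x - 2 * sZ (f x)) ^ 2 : ℤ) ≤ 8192 := by
    have h' : ((∑ x, (u' x - 2 * sZ (f x)) ^ 2 : ℤ) : ℝ) ≤ 8192 := by rw [hbud]; nlinarith
    exact_mod_cast h'
  set P := univ.filter (fun x : Fin (7 + 7) → Bool => Odd (u' x)) with hPdef
  have hmemP : ∀ x, x ∈ P ↔ Odd (u' x) := fun x => by simp [hPdef]
  have hsumP : (∑ x, (if Odd (u' x) then 1 else 0 : ℤ)) = #P := by rw [sum_boole]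
  have hnonneg : ∀ x, 0 ≤ (u' x - 2 * sZ (f x)) ^ 2 - (if Odd (u' x) then 1 else 0 : ℤ) := by
    intro x
    by_cases h : Odd (u' x)
    · rw [if_pos h]
      have hodd' : Odd (u' x - 2 * sZ (f x)) := Int.odd_sub.2 (iff_of_true h (even_two_mul _))
      have h0 := Int.odd_iff.1 hodd'
      have : u' x - 2 * sZ (f x) ≤ -1 ∨ 1 ≤ u' x - 2 * sZ (f x) := by omega
      have := tp_sq_ge (k := 1) (by norm_num) this
      linarith
    · rw [if_neg h]; have := sq_nonneg (u' x - 2 * sZ (f x)); linarith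
  have hsum0 : ∑ x, ((u' x - 2 * sZ (f x)) ^ 2 - (if Odd (u' x) then 1 else 0 : ℤ)) = 0 := by
    refine le_antisymm ?_ (sum_nonneg fun x _ => hnonneg x)
    rw [sum_sub_distrib, hsumP, hP]
    push_cast
    linarith
  have hzero' : ∀ x, (u' x - 2 * sZ (f x)) ^ 2 - (if Odd (u' x) then 1 else 0 : ℤ) = 0 :=
    fun x => (sum_eq_zero_iff_of_nonneg fun y _ => hnonneg y).1 hsum0 x (mem_univ x)
  have hoff : ∀ x, ¬ Odd (u' x) → u' x - 2 * sZ (f x) = 0 := by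
    intro x hx
    have h := hzero' x
    rw [if_neg hx, sub_zero] at h
    exact (pow_eq_zero_iff two_ne_zero).1 h
  have hon : ∀ x, Odd (u' x) → u' x - 2 * sZ (f x) = 1 ∨ u' x - 2 * sZ (f x) = -1 := by
    intro x hx
    have h := hzero' x
    rw [if_pos hx] at h
    have h1 : (u' x - 2 * sZ (f x)) * (u' x - 2 * sZ (f x)) = 1 := by rw [← pow_two]; linarith
    exact mul_self_eq_one_iff.1 h1
  have hΦeq : forrelation f g = 15 / 16 := by
    have hT : (∑ x, (u' x - 2 * sZ (f x)) ^ 2 : ℤ) = 8192 := by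
      have e1 : ∀ x, (u' x - 2 * sZ (f x)) ^ 2 = ((u' x - 2 * sZ (f x)) ^ 2 - (if Odd (u' x) then 1 else 0 : ℤ)) +
          (if Odd (u' x) then 1 else 0 : ℤ) := fun x => by ring
      rw [sum_congr rfl fun x _ => e1 x, sum_add_distrib, hsum0, hsumP, hP]; norm_num
    have h : ((∑ x, (u' x - 2 * sZ (f x)) ^ 2 : ℤ) : ℝ) = 8192 := by exact_mod_cast hT
    rw [hbud] at h
    linarith
  -- the parity is balanced, hence has a complementing structure `c`
  have hbal : ∑ y, signOf (decide (Odd (u' y))) = 0 := by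
    rw [fc_sum_signOf_eq_card]
    have hfilt : (univ.filter fun x : Fin (7 + 7) → Bool => decide (Odd (u' x)) = true) = P :=
      filter_congr fun x _ => by simp
    rw [hfilt, hP]; norm_num
  obtain ⟨c, hc0, hc⟩ := stub_quadBalancedStructure (7 + 7) (fun x => decide (Odd (u' x))) hp hbal
  have hc' : ∀ y, Odd (u' (bxor y c)) ↔ ¬ Odd (u' y) := by
    intro y
    have h := hc y
    by_cases h1 : Odd (u' y) <;> simp [h1] at h ⊢ <;> exact h
  -- the residual and its `c`-periodic extension
  set e : (Fin (7 + 7) → Bool) → ℤ := fun x => u' x - 2 * sZ (f x) with hedef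
  set E : (Fin (7 + 7) → Bool) → ℤ := fun x => e x + e (bxor x c) with hEdef
  have hE1 : ∀ x, E x = 1 ∨ E x = -1 := by
    intro x
    by_cases hx : Odd (u' x)
    · have h2 : e (bxor x c) = 0 := hoff _ (fun h => (hc' x).1 h hx)
      simp only [E, h2, add_zero]; exact hon x hx
    · have h1 : e x = 0 := hoff _ hx
      simp only [E, h1, zero_add]; exact hon _ ((hc' x).2 hx)
  set h₁ : (Fin (7 + 7) → Bool) → Bool := fun x => decide (E x = -1) with hh₁
  have hEh : ∀ x, E x = sZ (h₁ x) := fun x => fl1_sZ_decide (hE1 x)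
  -- parametrised flat sums of `E` are flat sums of `e` with the extra direction `c`
  have hpeel : ∀ {k : ℕ} (b : Fin (7 + 7) → Bool) (a : Fin k → Fin (7 + 7) → Bool),
      ∑ ε : Fin k → Bool, E (fun j => b j ^^ decide (Odd #(univ.filter fun i => ε i && a i j))) =
      ∑ ε : Fin (k + 1) → Bool, e (fun j => b j ^^ decide (Odd #(univ.filter fun i =>
        ε i && (Matrix.vecCons c a : Fin (k + 1) → Fin (7 + 7) → Bool) i j))) := by
    intro k b a
    rw [fr_sum_peel e b c a, ← sum_add_distrib]
  have hflat : ∀ {k : ℕ} (b : Fin (7 + 7) → Bool) (a : Fin (k + 1) → Fin (7 + 7) → Bool) (m : ℕ),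
      6 + m ≤ (k + 1) + (7 + 7 - (k + 1) + 2) / 3 → (2 : ℤ) ^ m ∣ 2 * 2 ^ ((k + 1 + 2) / 3) →
      (2 : ℤ) ^ m ∣ ∑ ε : Fin (k + 1) → Bool, e (fun j => b j ^^ decide (Odd #(univ.filter fun i => ε i && a i j))) := by
    intro k b a m hm hm2
    have h1 := fs_flat_sum_dvd (e := m) g u' hg hu' b a hm
    obtain ⟨zf, hzf⟩ := sl_sum_sZ_flat f hf b a
    have h2 : ∑ ε : Fin (k + 1) → Bool, e (fun j => b j ^^ decide (Odd #(univ.filter fun i => ε i && a i j))) =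
        ∑ ε : Fin (k + 1) → Bool, u' (fun j => b j ^^ decide (Odd #(univ.filter fun i => ε i && a i j))) -
        2 * ∑ ε : Fin (k + 1) → Bool, sZ (f (fun j => b j ^^ decide (Odd #(univ.filter fun i => ε i && a i j)))) := by
      simp only [e]; rw [sum_sub_distrib, mul_sum]
    rw [h2, hzf, ← mul_assoc]
    exact dvd_sub h1 (Dvd.dvd.mul_right hm2 _)
  -- `E` is `(−1)^{h₁}` with `h₁` QUADRATIC: coordinate cube sums of `E` are `≡ 0 (mod 4)`
  have hh₁ : IsDegLeFun 2 h₁ := by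
    refine bb_moebius_isDegLeFun 2 _ fun I hI => ?_
    have hk : #I ≤ 7 + 7 := (card_le_univ I).trans_eq (Fintype.card_fin _)
    obtain ⟨k, hkI⟩ : ∃ k, #I = k + 3 := ⟨#I - 3, by omega⟩
    have h4 : (4 : ℤ) ∣ ∑ x ∈ univ.filter (fun x : Fin (7 + 7) → Bool => ∀ i, x i = true → i ∈ I), E x := by
      rw [fo_sum_cube_eq_flat E I, hpeel, show (4 : ℤ) = 2 ^ 2 by norm_num]
      exact hflat (k := #I) zeroVec (Matrix.vecCons c fun i : Fin #I =>
        (Pi.single (I.orderEmbOfFin rfl i) true : Fin (7 + 7) → Bool)) 2 (by omega)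
        (by obtain ⟨m', hm'⟩ : ∃ m', (#I + 1 + 2) / 3 = m' + 1 := ⟨(#I + 1 + 2) / 3 - 1, by omega⟩
            rw [hm', pow_succ]; exact ⟨2 ^ m', by ring⟩)
    have hsum : ∑ x ∈ univ.filter (fun x : Fin (7 + 7) → Bool => ∀ i, x i = true → i ∈ I), E x =
        2 ^ #I - 2 * #(univ.filter fun x : Fin (7 + 7) → Bool => (∀ i, x i = true → i ∈ I) ∧ h₁ x = true) := by
      rw [sum_congr rfl fun x _ => (hEh x).trans (fo_sZ_eq (h₁ x)), sum_sub_distrib, ← mul_sum, sum_boole, filter_filter,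
        sum_const, bb_card_cube]
      push_cast; ring
    rw [hsum, hkI, show (2 : ℤ) ^ (k + 3) = 4 * (2 * 2 ^ k) by ring] at h4
    have h2 : (4 : ℤ) ∣ 2 * #(univ.filter fun x : Fin (7 + 7) → Bool => (∀ i, x i = true → i ∈ I) ∧ h₁ x = true) := by
      have := dvd_sub (dvd_mul_right 4 (2 * 2 ^ k)) h4
      rwa [sub_sub_cancel] at this
    obtain ⟨q, hq⟩ := h2
    refine Nat.even_iff.2 ?_
    omega
  -- 6-flat sums of `E` are `≡ 0 (mod 16)`; hence the radical of `h₁` is large (rank `≤ 4`)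
  have h16 : ∀ (b : Fin (7 + 7) → Bool) (a : Fin 6 → Fin (7 + 7) → Bool),
      (16 : ℤ) ∣ ∑ ε : Fin 6 → Bool, E (fun j => b j ^^ decide (Odd #(univ.filter fun i => ε i && a i j))) := by
    intro b a
    rw [hpeel, show (16 : ℤ) = 2 ^ 4 by norm_num]
    exact hflat b (Matrix.vecCons c a) 4 (by norm_num) (by norm_num)
  set R₁ := univ.filter (fun a : Fin (7 + 7) → Bool => ∀ b, (h₁ zeroVec ^^ h₁ a ^^ h₁ b ^^ h₁ (bxor a b)) = false) with hR₁
  have hR₁ge : 1024 ≤ #R₁ := by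
    by_contra hlt
    push Not at hlt
    obtain ⟨a₀, a₁, a₂, a₃, a₄, a₅, h01, h23, h45, h02, h03, h12, h13, h04, h05, h14, h15, h24, h25, h34, h35⟩ :=
      ss_extract3 h₁ hh₁ (by rw [← hR₁]; norm_num; omega)
    have hss := ss_flat_signsum6 h₁ hh₁ a₀ a₁ a₂ a₃ a₄ a₅ h01 h23 h45 h02 h03 h12 h13 h04 h05 h14 h15 h24 h25 h34 h35 zeroVec
    have hcast : ∑ ε : Fin 6 → Bool, signOf (h₁ (fun j => zeroVec j ^^ decide (Odd #(univ.filter fun i =>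
        ε i && (![a₀, a₁, a₂, a₃, a₄, a₅] i) j)))) =
        ((∑ ε : Fin 6 → Bool, E (fun j => zeroVec j ^^ decide (Odd #(univ.filter fun i =>
          ε i && (![a₀, a₁, a₂, a₃, a₄, a₅] i) j))) : ℤ) : ℝ) := by
      push_cast
      exact sum_congr rfl fun ε _ => by rw [hEh, tp_sZ_cast]
    have hd := h16 zeroVec ![a₀, a₁, a₂, a₃, a₄, a₅]
    rw [hcast] at hss
    rcases hss with h8 | h8
    · have h8' : (∑ ε : Fin 6 → Bool, E (fun j => zeroVec j ^^ decide (Odd #(univ.filter fun i =>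
          ε i && (![a₀, a₁, a₂, a₃, a₄, a₅] i) j))) : ℤ) = 8 := by exact_mod_cast h8
      rw [h8'] at hd; norm_num at hd
    · have h8' : (∑ ε : Fin 6 → Bool, E (fun j => zeroVec j ^^ decide (Odd #(univ.filter fun i =>
          ε i && (![a₀, a₁, a₂, a₃, a₄, a₅] i) j))) : ℤ) = -8 := by exact_mod_cast h8
      rw [h8'] at hd; norm_num at hd
  -- the twisted pattern `h₂ = h₁ ⊕ p` is quadratic of rank `≤ 4` as well
  set h₂ : (Fin (7 + 7) → Bool) → Bool := fun x => h₁ x ^^ decide (Odd (u' x)) with hh₂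
  have hh₂ : IsDegLeFun 2 h₂ := bb_isDegLeFun_bxor hh₁ hp
  have hE2 : ∀ x, (sZ (h₂ x) : ℤ) = E x - 2 * e x := by
    intro x
    by_cases hx : Odd (u' x)
    · have h2 : e (bxor x c) = 0 := hoff _ (fun h => (hc' x).1 h hx)
      have hEx : E x = e x := by simp only [E, h2, add_zero]
      have hb : h₂ x = !h₁ x := by simp only [h₂, decide_eq_true hx, Bool.xor_true]
      rw [hb, hEx.symm.trans (hEh x), hEh x]
      cases h₁ x <;> simp [sZ]
    · have h1 : e x = 0 := hoff _ hx
      have hb : h₂ x = h₁ x := by simp only [h₂, decide_eq_false hx, Bool.xor_false]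
      rw [hb, h1, hEh x]; ring
  have h16' : ∀ (b : Fin (7 + 7) → Bool) (a : Fin 6 → Fin (7 + 7) → Bool),
      (16 : ℤ) ∣ ∑ ε : Fin 6 → Bool, sZ (h₂ (fun j => b j ^^ decide (Odd #(univ.filter fun i => ε i && a i j)))) := by
    intro b a
    rw [sum_congr rfl fun ε _ => hE2 _, sum_sub_distrib, ← mul_sum]
    refine dvd_sub (h16 b a) ?_
    obtain ⟨a5, ha5⟩ : ∃ a5 : Fin 5 → Fin (7 + 7) → Bool, ∃ t, a = Matrix.vecCons t a5 :=
      ⟨Matrix.vecTail a, Matrix.vecHead a, (Matrix.cons_head_tail a).symm⟩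
    obtain ⟨t, rfl⟩ := ha5
    have := hflat b (Matrix.vecCons t a5) 3 (by norm_num) (by norm_num)
    rw [show (16 : ℤ) = 2 * 2 ^ 3 by norm_num]
    exact mul_dvd_mul_left 2 this
  set R₂ := univ.filter (fun a : Fin (7 + 7) → Bool => ∀ b, (h₂ zeroVec ^^ h₂ a ^^ h₂ b ^^ h₂ (bxor a b)) = false) with hR₂
  have hR₂ge : 1024 ≤ #R₂ := by
    by_contra hlt
    push Not at hlt
    obtain ⟨a₀, a₁, a₂, a₃, a₄, a₅, h01, h23, h45, h02, h03, h12, h13, h04, h05, h14, h15, h24, h25, h34, h35⟩ :=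
      ss_extract3 h₂ hh₂ (by rw [← hR₂]; norm_num; omega)
    have hss := ss_flat_signsum6 h₂ hh₂ a₀ a₁ a₂ a₃ a₄ a₅ h01 h23 h45 h02 h03 h12 h13 h04 h05 h14 h15 h24 h25 h34 h35 zeroVec
    have hcast : ∑ ε : Fin 6 → Bool, signOf (h₂ (fun j => zeroVec j ^^ decide (Odd #(univ.filter fun i =>
        ε i && (![a₀, a₁, a₂, a₃, a₄, a₅] i) j)))) =
        ((∑ ε : Fin 6 → Bool, sZ (h₂ (fun j => zeroVec j ^^ decide (Odd #(univ.filter fun i =>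
          ε i && (![a₀, a₁, a₂, a₃, a₄, a₅] i) j)))) : ℤ) : ℝ) := by
      push_cast
      exact sum_congr rfl fun ε _ => by rw [tp_sZ_cast]
    have hd := h16' zeroVec ![a₀, a₁, a₂, a₃, a₄, a₅]
    rw [hcast] at hss
    rcases hss with h8 | h8
    · have h8' : (∑ ε : Fin 6 → Bool, sZ (h₂ (fun j => zeroVec j ^^ decide (Odd #(univ.filter fun i =>
          ε i && (![a₀, a₁, a₂, a₃, a₄, a₅] i) j)))) : ℤ) = 8 := by exact_mod_cast h8
      rw [h8'] at hd; norm_num at hd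
    · have h8' : (∑ ε : Fin 6 → Bool, sZ (h₂ (fun j => zeroVec j ^^ decide (Odd #(univ.filter fun i =>
          ε i && (![a₀, a₁, a₂, a₃, a₄, a₅] i) j)))) : ℤ) = -8 := by exact_mod_cast h8
      rw [h8'] at hd; norm_num at hd
  -- radicals: closure and periods up to sign
  have hrad0 : ∀ (q : (Fin (7 + 7) → Bool) → Bool),
      zeroVec ∈ univ.filter (fun a : Fin (7 + 7) → Bool => ∀ b, (q zeroVec ^^ q a ^^ q b ^^ q (bxor a b)) = false) := by
    intro q
    refine mem_filter.2 ⟨mem_univ _, fun b => ?_⟩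
    rw [zeroVec_bxor]; cases q zeroVec <;> cases q b <;> rfl
  have hradd : ∀ (q : (Fin (7 + 7) → Bool) → Bool), IsDegLeFun 2 q →
      ∀ a ∈ univ.filter (fun a : Fin (7 + 7) → Bool => ∀ b, (q zeroVec ^^ q a ^^ q b ^^ q (bxor a b)) = false),
      ∀ a' ∈ univ.filter (fun a : Fin (7 + 7) → Bool => ∀ b, (q zeroVec ^^ q a ^^ q b ^^ q (bxor a b)) = false),
        bxor a a' ∈ univ.filter (fun a : Fin (7 + 7) → Bool => ∀ b, (q zeroVec ^^ q a ^^ q b ^^ q (bxor a b)) = false) := by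
    intro q hq a ha a' ha'
    refine mem_filter.2 ⟨mem_univ _, fun b => ?_⟩
    rw [es_B_add_left q hq a a' b, (mem_filter.1 ha).2 b, (mem_filter.1 ha').2 b]
    rfl
  have hper : ∀ (q : (Fin (7 + 7) → Bool) → Bool),
      ∀ a ∈ univ.filter (fun a : Fin (7 + 7) → Bool => ∀ b, (q zeroVec ^^ q a ^^ q b ^^ q (bxor a b)) = false),
      ∃ cc : ℝ, (cc = 1 ∨ cc = -1) ∧ ∀ x, signOf (q (bxor x a)) = cc * signOf (q x) := by
    intro q a ha
    refine ⟨signOf (q zeroVec ^^ q a), ?_, fun x => ?_⟩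
    · unfold signOf; split_ifs <;> simp
    · have h := (mem_filter.1 ha).2 x
      rw [bxor_comm] at h
      have e1 : q (bxor x a) = (q x ^^ (q zeroVec ^^ q a)) := by
        revert h; cases q zeroVec <;> cases q a <;> cases q x <;> cases q (bxor x a) <;> decide
      rw [e1, signOf_xor]; ring
  -- the two `L¹` bounds
  set A₁ : (Fin (7 + 7) → Bool) → ℝ := fun x => signOf (h₁ x) with hA₁
  set A₂ : (Fin (7 + 7) → Bool) → ℝ := fun x => signOf (h₂ x) with hA₂
  have hL1 : ∀ (q : (Fin (7 + 7) → Bool) → Bool), IsDegLeFun 2 q →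
      1024 ≤ #(univ.filter (fun a : Fin (7 + 7) → Bool => ∀ b, (q zeroVec ^^ q a ^^ q b ^^ q (bxor a b)) = false)) →
      ∑ y, |W (fun x => signOf (q x)) y| ≤ 65536 := by
    intro q hq hR
    have hb := fp_l1_sq_mul_le (fun x => signOf (q x)) univ _ (fun x _ => by unfold signOf; split_ifs <;> simp)
      (fun x hx => absurd (mem_univ x) hx) (hrad0 q) (hradd q hq) (hper q)
    rw [card_univ, Fintype.card_fun, Fintype.card_bool, Fintype.card_fin] at hb
    have hRr : (1024 : ℝ) ≤ #(univ.filter (fun a : Fin (7 + 7) → Bool => ∀ b, (q zeroVec ^^ q a ^^ q b ^^ q (bxor a b)) = false)) := by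
      exact_mod_cast hR
    have hnn : 0 ≤ ∑ y, |W (fun x => signOf (q x)) y| := sum_nonneg fun y _ => abs_nonneg _
    push_cast at hb
    have h2 : (∑ y, |W (fun x => signOf (q x)) y|) ^ 2 * 1024 ≤
        (∑ y, |W (fun x => signOf (q x)) y|) ^ 2 *
          #(univ.filter (fun a : Fin (7 + 7) → Bool => ∀ b, (q zeroVec ^^ q a ^^ q b ^^ q (bxor a b)) = false)) :=
      mul_le_mul_of_nonneg_left hRr (sq_nonneg _)
    nlinarith
  have hX := hL1 h₁ hh₁ hR₁ge
  have hY := hL1 h₂ hh₂ hR₂ge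
  -- decomposition `u − 4s = A₁ − A₂` and the pairing
  have hdecomp : (fun x => (u x : ℝ) - (2 : ℝ) ^ 2 * signOf (f x)) = fun x => A₁ x + (-1) * A₂ x := by
    funext x
    have h2 : (u x : ℝ) - (2 : ℝ) ^ 2 * signOf (f x) = 2 * ((e x : ℤ) : ℝ) := by
      simp only [u, e]; push_cast; rw [tp_sZ_cast]; ring
    have h3 : (2 : ℝ) * ((e x : ℤ) : ℝ) = ((E x : ℤ) : ℝ) - ((sZ (h₂ x) : ℤ) : ℝ) := by
      rw [hE2 x]; push_cast; ring
    rw [h2, h3, hEh x, tp_sZ_cast, tp_sZ_cast]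
    simp only [A₁, A₂]; ring
  have hpair := tms_pairing 2 f g u hu5
  rw [hΦeq, hdecomp] at hpair
  have e2 : ∀ y, signOf (g y) * W (fun x => A₁ x + (-1) * A₂ x) y =
      signOf (g y) * W A₁ y + (-1) * (signOf (g y) * W A₂ y) := fun y => by
    rw [sp_W_add, fl1_W_smul]; ring
  rw [sum_congr rfl fun y _ => e2 y, sum_add_distrib, ← mul_sum] at hpair
  have hP1 : ∑ y, signOf (g y) * W A₁ y ≤ ∑ y, |W A₁ y| := fl1_pairing_le_l1 g (W A₁)
  have hP2 : |∑ y, signOf (g y) * W A₂ y| ≤ ∑ y, |W A₂ y| :=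
    (abs_sum_le_sum_abs _ _).trans (sum_le_sum fun y _ => by
      rw [abs_mul]; unfold signOf; split_ifs <;> norm_num)
  have hP2' := (abs_le.1 hP2).1
  have h23 : (2 : ℝ) ^ (10 * 2 + 3) * (1 - 15 / 16) = 524288 := by norm_num
  rw [h23] at hpair
  simp only [A₁, A₂] at hP1 hP2' hpair hX hY
  linarith

end Summit.QuantumAdvantage.QuantumAdvantage.Theorems.CubicForrelation.NearExactIsExact

end
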